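import Literature.Computability.Complexity.HiraharaTable
import Literature.Computability.Complexity.HiraharaLayout
import Literature.Computability.Complexity.SoundnessAssembly
import Literature.Computability.MetaComplexity.NWLexicodeLinear
import HarnessLib

/-!
# Hirahara's reduction: the concrete instance (parameters, designs, data) and its two guarantees

Topic `Computability/Complexity`. The concrete parameter choice of Hirahara's reduction from CMMSA
to `MCSP*` (ECCC TR22-119, proof of Lemma 8.3, "Parameters and the distribution", p. 28, and
proof of Thm. 8.5, p. 31) for a PREPROCESSED instance (`HiraharaRed.PInst`: `n` variables with
weights, `ν` non-constant monotone DNFs, threshold `θ`, the logarithm `logLam` of the size parameter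
`λ = 2^{logLam}`): `Δ = (log n)^{1/2}`, `mm = Δ` share slots, `k_A = 96 Δ²` amplification queries,
cap `C = 3072 Δ⁴`, `η = 1/(4Δ²)`, arities `N_k = ⌊log₂(max(1,w_k)·λ)⌋ + 1`, the GREEDY designs of
`NWLexicodeLinear.lean` / `NWLexicodeDesigns.lean` (amplification: `r = 2`; Nisan–Wigderson layer:
`r = 140`), Hankel indices =
binary digits, the explicit block identification of `HiraharaLayout.lean`, slots = distinct variables
in order of appearance, and the circuit-size threshold `s_P` (`HiraharaRed.PInst.sP`). The output is
`HiraharaRed.PInst.output I F = tableCode …` (`HiraharaTable.lean`).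

Main results (with the asymptotic inequalities kept as explicit, named hypotheses — they are
discharged for `n ≥ n₀(α)` in the asymptotics file):

* `HiraharaRed.PInst.output_mem_of_witness` — **completeness**: a set `T` of positive-weight
  variables with `w(T) ≤ θ` accepted by every formula puts the output in `MCSP*` for EVERY coin
  outcome;
* `HiraharaRed.PInst.card_output_mem_mul_three_le` — **soundness**: if every set accepted by all
  formulas has weight `> W₀`, at most a third of the coin outcomes put the output in `MCSP*`.

## References

* S. Hirahara, *NP-hardness of learning programs and partial MCSP*, ECCC TR22-119, proof of
  Lemma 8.3 (pp. 28–30) and of Thm. 8.5 (p. 31) [Hirahara2022PartialMCSP].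
-/

namespace Literature.Computability.Complexity

open Finset
open Literature.Computability.MetaComplexity (MonotoneDNF MCSPStar sqrtLog)
open Literature.Computability.MetaComplexity.NWLexLinear (linDesign isNWDesign_linDesign)
open Literature.Computability.MetaComplexity.MonotoneDNF (BenalohLeichter.Rand)

namespace HiraharaRed

/-! ### Preprocessed instances and their parameters -/

/-- **A preprocessed CMMSA instance**: `n` variables with weights `w`, `ν` non-constant monotone DNF
formulas over `[n]`, the threshold `θ`, and the logarithm `logLam` of the size parameter `λ = 2^{logLam}`
chosen by the reduction. [cite: Hirahara2022PartialMCSP, proof of Lemma 8.3 ("Let (Φ, w, θ) be an instance of CMMSA … λ")] -/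
structure PInst where
  /-- number of variables -/
  n : ℕ
  /-- number of (non-constant) formulas -/
  ν : ℕ
  /-- the formulas -/
  φ : Fin ν → MonotoneDNF
  /-- the weights -/
  w : Fin n → ℕ
  /-- the threshold -/
  θ : ℕ
  /-- `log₂ λ` -/
  logLam : ℕ

namespace PInst

open scoped Classical

variable (I : PInst)

/-- `Δ = (log n)^{1/2}`. [cite: Hirahara2022PartialMCSP, proof of Thm. 8.5 (Δ(n) := (log n)^{1/2})] -/
def Δ : ℕ := sqrtLog I.n

/-- `λ = 2^{logLam}`. [cite: Hirahara2022PartialMCSP, proof of Lemma 8.3 (the parameter λ)] -/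
def lam : ℕ := 2 ^ I.logLam

/-- Index bits for `j`: `Lj = ⌊log₂ ν⌋ + 1`. [folklore] -/
def Lj : ℕ := Nat.log 2 I.ν + 1

/-- Amplification queries `k_A = 96 Δ²`. [cite: Hirahara2022PartialMCSP, Lemma 8.1 (k = O(log²(1/ϵδ)) … here poly(1/η))] -/
def kA : ℕ := 96 * (I.Δ * I.Δ)

/-- The cap `C = 3072 Δ⁴` of the list-decoding measure. [cite: Hirahara2022PartialMCSP, Lemma 8.1] -/
def Ccap : ℕ := 3072 * (I.Δ * I.Δ) ^ 2

/-- `η = 1/(4Δ²)` (so `η · mm · Δ = 1/4`). [cite: Hirahara2022PartialMCSP, Lemma 6.6 (ε/m')] -/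
noncomputable def η : ℝ := 1 / (4 * (I.Δ * I.Δ : ℝ))

/-- The arity `N_k = ⌊log₂(max(1,w_k) · λ)⌋ + 1` of `f_k` (so `λ w_k < 2^{N_k} ≤ 2 λ max(1,w_k)`).
[cite: Hirahara2022PartialMCSP, proof of Lemma 8.3 ("fᵢ ∼ {0,1}^{λ w(i)}")] -/
def N (k : Fin I.n) : ℕ := Nat.log 2 (max 1 (I.w k) * I.lam) + 1

/-- The Hankel parameter `mI = ⌊log₂ k_A⌋ + 1` (so `k_A < 2^{mI}`). [cite: Hirahara2022PartialMCSP, proof of Lemma 8.1 (r ∈ {0,1}^{O(n)})] -/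
def mI : ℕ := Nat.log 2 I.kA + 1

/-- The Hankel indices: binary digits. [cite: Hirahara2022PartialMCSP, proof of Lemma 8.1 (pairwise independent generator)] -/
def idxA (i : Fin I.kA) : Fin I.mI → ZMod 2 := fun c => if i.val.testBit c then 1 else 0

/-- The amplification design of variable `k`: the greedy-code design with `r = 2` (universe
`[16 N_k]`, intersections `≤ N_k/2`) if the sizes allow (junk otherwise).
[cite: Hirahara2022PartialMCSP, proof of Lemma 8.1 ("(n, γn)-design … Proposition 6.2")] -/
noncomputable def eA (k : Fin I.n) : Fin I.kA → (Fin (I.N k) ↪ Fin (I.N k * 4 ^ 2)) :=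
  if h : 1 ≤ I.N k ∧ I.kA ≤ 2 ^ I.N k then linDesign 2 (I.N k) I.kA le_rfl h.1 h.2
  else fun _ => Fin.castLEEmb (Nat.le_mul_of_pos_right _ (by norm_num))

/-- The raw amplification data. [cite: Hirahara2022PartialMCSP, proof of Lemma 8.3] -/
noncomputable def raw : RawAmp I.n I.kA where
  N := I.N
  dA k := I.N k * 4 ^ 2
  mI _ := I.mI
  eA := I.eA
  idxA _ := I.idxA

/-- The common block length `ℓ = max_k seedLen k`. [cite: Hirahara2022PartialMCSP, proof of Lemma 8.3 (ℓ := c⌈log(w_max λ)⌉)] -/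
noncomputable def ℓ : ℕ := (univ : Finset (Fin I.n)).sup I.raw.seedLen

/-- Every seed fits in a block. [folklore] -/
theorem seedLen_le_ℓ (k : Fin I.n) : I.raw.seedLen k ≤ I.ℓ := Finset.le_sup (f := I.raw.seedLen) (mem_univ k)

/-- The amplification data with the explicit block identification. [cite: Hirahara2022PartialMCSP, proof of Lemma 8.3] -/
noncomputable def A : AmpData I.n I.ℓ I.kA := mkAmpData I.raw I.ℓ I.seedLen_le_ℓ

/-- Its layout. [cite: Hirahara2022PartialMCSP, proof of Lemma 8.3] -/
noncomputable def L : Layout I.A := mkLayout I.raw I.ℓ I.seedLen_le_ℓ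

/-- The Nisan–Wigderson universe `d = ℓ · 4^{140}`. [cite: Hirahara2022PartialMCSP, Prop. 6.2 and proof of Lemma 8.3 (d = O(ℓ))] -/
noncomputable def dNW : ℕ := I.ℓ * 4 ^ 140

/-- The Nisan–Wigderson design on the positions `[n] × [Δ]`: the greedy-code design with `r = 140`
(intersections `≤ ℓ/140`) if the sizes allow (junk otherwise).
[cite: Hirahara2022PartialMCSP, proof of Lemma 8.3 ("(ℓ, ρ)-design S = (S_{i,j})")] -/
noncomputable def E : Fin I.n × Fin I.Δ → (Fin I.ℓ ↪ Fin I.dNW) :=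
  if h : 1 ≤ I.ℓ ∧ I.n * I.Δ ≤ 2 ^ I.ℓ then fun p => linDesign 140 I.ℓ (I.n * I.Δ) (by norm_num) h.1 h.2 (finProdFinEquiv p)
  else fun _ => Fin.castLEEmb (Nat.le_mul_of_pos_right _ (by norm_num))

/-- The distinct variables of formula `j`, in order of appearance. [cite: Hirahara2022PartialMCSP, proof of Lemma 8.3 ("let V := {v₁, …, v_m} be the set of variables in φ")] -/
def vars (j : Fin I.ν) : List ℕ := ((I.φ j).flatMap id).dedup

/-- **The slots**: slot `i` of formula `j` holds its `i`-th distinct variable. [cite: Hirahara2022PartialMCSP, proof of Lemma 8.3] -/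
def slot (j : Fin I.ν) (i : Fin I.Δ) : Option (Fin I.n) :=
  if h : i.val < (I.vars j).length then
    (if hv : (I.vars j)[i.val] < I.n then some ⟨_, hv⟩ else none)
  else none

/-- The log of the per-variable polylog budget: `τ = ⌊log₂(Δ k_A)⌋ + 1`. [folklore] -/
def τ : ℕ := Nat.log 2 (I.Δ * I.kA) + 1

/-- The largest arity. [folklore] -/
def Nbig : ℕ := Nat.log 2 (max 1 ((univ : Finset (Fin I.n)).sup I.w) * I.lam) + 1

/-- **The circuit-size threshold `s_P`** (completeness budget: mass production of the witness
variables + polylogarithmic overheads). [cite: Hirahara2022PartialMCSP, proof of Thm. 8.5 (s_P := O(s / log s), s = θλ) and proof of Lemma 8.3 (completeness)] -/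
def sP : ℕ :=
  320 * I.lam * I.θ / I.logLam + I.n * (I.Δ * I.kA * (I.Nbig * (2 * I.mI + 3)) + I.Δ * (I.kA + 1)) +
    (Lupanov.mintermBound I.Lj + I.ν * (2 * I.Δ + 1) + (2 * I.ν + 1))

/-- **The output**: the `MCSP*` instance of the coin outcome `F`. [cite: Hirahara2022PartialMCSP, proof of Thm. 8.5 (MCSP* case: output (f, s_P))] -/
noncomputable def output (F : Coins I.A) : List Bool :=
  tableCode I.Lj I.E (Fhat I.A F) I.φ I.slot I.sP

/-! ### Basic facts about the parameters -/

/-- Well-formedness of the formulas of a preprocessed instance. [cite: Hirahara2022PartialMCSP, Def. 5.1 and proof of Lemma 8.3] -/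
structure Good : Prop where
  /-- `n ≥ 2`, so `Δ ≥ 1` -/
  two_le_n : 2 ≤ I.n
  /-- no empty term (non-constant) -/
  nil_notMem : ∀ j, [] ∉ I.φ j
  /-- some term (non-constant) -/
  ne_nil : ∀ j, I.φ j ≠ []
  /-- degree bound -/
  numLiterals_le : ∀ j, (I.φ j).numLiterals ≤ I.Δ
  /-- formulas over `[n]` -/
  isOver : ∀ j, (I.φ j).IsOver I.n
  /-- `λ ≥ 16` -/
  four_le_logLam : 4 ≤ I.logLam

/-- `Δ ≥ 1` when `n ≥ 2`. [folklore] -/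
theorem one_le_Δ (h : 2 ≤ I.n) : 1 ≤ I.Δ := by
  unfold Δ; rw [MetaComplexity.sqrtLog]
  have : 1 ≤ Nat.log 2 I.n := Nat.le_log_of_pow_le (by norm_num) (by simpa using h)
  exact Nat.le_sqrt.2 (by simpa using this)

/-- `k_A ≥ 96 > 0` when `Δ ≥ 1`. [folklore] -/
theorem kA_pos (h : 2 ≤ I.n) : 0 < I.kA := by
  have := I.one_le_Δ h; unfold kA; positivity

/-- The Hankel indices are injective (`k_A < 2^{mI}`). [folklore] -/
theorem idxA_injective : Function.Injective I.idxA := by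
  intro i i' h
  apply Fin.ext
  apply Nat.eq_of_testBit_eq
  intro c
  by_cases hc : c < I.mI
  · have := congrFun h ⟨c, hc⟩
    simp only [idxA] at this
    revert this
    cases i.val.testBit c <;> cases i'.val.testBit c <;> simp
  · have hlt : ∀ x : Fin I.kA, x.val < 2 ^ c := fun x =>
      lt_of_lt_of_le (lt_of_lt_of_le x.isLt (Nat.lt_pow_succ_log_self (by norm_num) _).le)
        (Nat.pow_le_pow_right (by norm_num) (by unfold mI at hc; omega))
    rw [Nat.testBit_eq_false_of_lt (hlt i), Nat.testBit_eq_false_of_lt (hlt i')]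

/-- `k_A η = 24`. [folklore] -/
theorem kA_mul_η (h : 2 ≤ I.n) : (I.kA : ℝ) * I.η = 24 := by
  have hΔ : (1 : ℝ) ≤ I.Δ := by exact_mod_cast I.one_le_Δ h
  unfold kA η
  push_cast
  field_simp
  ring

/-- `C η = 8 k_A`. [folklore] -/
theorem Ccap_mul_η (h : 2 ≤ I.n) : (I.Ccap : ℝ) * I.η = 8 * I.kA := by
  have hΔ : (1 : ℝ) ≤ I.Δ := by exact_mod_cast I.one_le_Δ h
  unfold Ccap kA η
  push_cast
  field_simp
  ring

/-- `η · mm · Δ = 1/4 < 1/2`. [folklore] -/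
theorem η_mul_lt (h : 2 ≤ I.n) : I.η * (I.Δ * I.Δ : ℝ) < 1 / 2 := by
  have hΔ : (1 : ℝ) ≤ I.Δ := by exact_mod_cast I.one_le_Δ h
  unfold η
  have : (0 : ℝ) < I.Δ * I.Δ := by positivity
  rw [div_mul_eq_mul_div, one_mul, div_lt_iff₀ (by positivity)]
  nlinarith

/-- `η > 0`. [folklore] -/
theorem η_pos (h : 2 ≤ I.n) : 0 < I.η := by
  have hΔ : (1 : ℝ) ≤ I.Δ := by exact_mod_cast I.one_le_Δ h
  unfold η; positivity

/-- `ν ≤ 2^{Lj}`. [folklore] -/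
theorem ν_le : I.ν ≤ 2 ^ I.Lj := (Nat.lt_pow_succ_log_self (by norm_num) _).le

/-- `Δ k_A ≤ 2^τ`. [folklore] -/
theorem Δ_mul_kA_le : I.Δ * I.kA ≤ 2 ^ I.τ := (Nat.lt_pow_succ_log_self (by norm_num) _).le

/-- The arities: `λ · max(1, w_k) < 2^{N_k}`. [folklore] -/
theorem lam_mul_lt_two_pow_N (k : Fin I.n) : max 1 (I.w k) * I.lam < 2 ^ I.N k :=
  Nat.lt_pow_succ_log_self (by norm_num) _

/-- The arities: `2^{N_k} ≤ 2 λ max(1, w_k)`. [folklore] -/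
theorem two_pow_N_le (k : Fin I.n) : 2 ^ I.N k ≤ 2 * (max 1 (I.w k) * I.lam) := by
  unfold N
  rw [pow_succ]
  have : 2 ^ Nat.log 2 (max 1 (I.w k) * I.lam) ≤ max 1 (I.w k) * I.lam :=
    Nat.pow_log_le_self 2 (by unfold lam; positivity)
  omega

/-- `N_k ≥ logLam + 1`. [folklore] -/
theorem logLam_lt_N (k : Fin I.n) : I.logLam < I.N k := by
  unfold N lam
  have : I.logLam ≤ Nat.log 2 (max 1 (I.w k) * 2 ^ I.logLam) := by
    calc I.logLam = Nat.log 2 (2 ^ I.logLam) := (Nat.log_pow (by norm_num) _).symm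
      _ ≤ _ := Nat.log_mono_right (Nat.le_mul_of_pos_left _ (by positivity))
  omega

/-- `N_k ≤ Nbig`. [folklore] -/
theorem N_le_Nbig (k : Fin I.n) : I.N k ≤ I.Nbig := by
  unfold N Nbig
  have hw : I.w k ≤ (univ : Finset (Fin I.n)).sup I.w := Finset.le_sup (f := I.w) (mem_univ k)
  have : max 1 (I.w k) * I.lam ≤ max 1 ((univ : Finset (Fin I.n)).sup I.w) * I.lam :=
    Nat.mul_le_mul_right _ (max_le_max le_rfl hw)
  exact Nat.succ_le_succ (Nat.log_mono_right this)

/-- **The slots cover every literal** (variables `< n`, at most `Δ` distinct ones). [cite: Hirahara2022PartialMCSP, proof of Lemma 8.3] -/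
theorem slot_cover (hG : I.Good) (j : Fin I.ν) (t : List ℕ) (ht : t ∈ I.φ j) (v : ℕ) (hv : v ∈ t) :
    ∃ (k : Fin I.n) (i : Fin I.Δ), k.val = v ∧ I.slot j i = some k := by
  have hvn : v < I.n := hG.isOver j t ht v hv
  have hmem : v ∈ I.vars j := by
    unfold vars; rw [List.mem_dedup, List.mem_flatMap]; exact ⟨t, ht, hv⟩
  obtain ⟨i, hi, hiv⟩ := List.getElem_of_mem hmem
  have hlen : (I.vars j).length ≤ I.Δ := by
    calc (I.vars j).length ≤ ((I.φ j).flatMap id).length := List.Sublist.length_le (List.dedup_sublist _)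
      _ = (I.φ j).numLiterals := by
          unfold MonotoneDNF.numLiterals
          rw [List.length_flatMap]; simp
      _ ≤ I.Δ := hG.numLiterals_le j
  refine ⟨⟨v, hvn⟩, ⟨i, lt_of_lt_of_le hi hlen⟩, rfl, ?_⟩
  unfold slot
  simp only [hi, dif_pos]
  subst hiv
  simp [hvn]

/-! ### Completeness of the concrete instance -/

/-- `∑ (a_k / L) ≤ (∑ a_k) / L` in `ℕ`. [folklore] -/
theorem sum_div_le {ι : Type*} (s : Finset ι) (a : ι → ℕ) (L : ℕ) :
    ∑ k ∈ s, a k / L ≤ (∑ k ∈ s, a k) / L := by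
  rcases Nat.eq_zero_or_pos L with rfl | hL
  · simp
  rw [Nat.le_div_iff_mul_le hL, Finset.sum_mul]
  exact Finset.sum_le_sum fun k _ => Nat.div_mul_le_self _ _

/-- **The completeness budget fits in `s_P`**: for a set `T` of positive-weight variables of total
weight `≤ θ`, `costT(T) + overheads ≤ s_P`. [cite: Hirahara2022PartialMCSP, proof of Lemma 8.3 (completeness: size Σ_{i∈T} O(λ w(i)/log(λ w(i))) + … = O(s/log s))] -/
theorem costT_add_le_sP (hG : I.Good) (T : Finset (Fin I.n)) (hTw : ∀ k ∈ T, 1 ≤ I.w k)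
    (hTθ : ∑ k ∈ T, I.w k ≤ I.θ) :
    costT I.A T I.Δ I.kA + (Lupanov.mintermBound I.Lj + I.ν * (2 * I.Δ + 1) + (2 * I.ν + 1)) ≤ I.sP := by
  unfold sP
  refine Nat.add_le_add_right ?_ _
  have hlog : 1 ≤ I.logLam := le_trans (by norm_num) hG.four_le_logLam
  -- split `costK` into the polylogarithmic part and the mass-production part
  have hsplit : costT I.A T I.Δ I.kA =
      ∑ k ∈ T, (I.Δ * I.kA * (I.N k * (2 * I.mI + 3)) + I.Δ * (I.kA + 1)) +
        ∑ k ∈ T, 160 * 2 ^ I.N k / I.N k := by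
    unfold costT costK
    rw [← Finset.sum_add_distrib]
    refine Finset.sum_congr rfl fun k _ => ?_
    change I.Δ * I.kA * (I.N k * (2 * I.mI + 3)) + 160 * 2 ^ I.N k / I.N k + I.Δ * (I.kA + 1) = _
    ring
  rw [hsplit, add_comm]
  refine Nat.add_le_add ?_ ?_
  · -- mass production: `Σ 160·2^{N_k}/N_k ≤ 320 λ θ / logLam`
    calc ∑ k ∈ T, 160 * 2 ^ I.N k / I.N k ≤ ∑ k ∈ T, 320 * I.lam * I.w k / I.logLam := by
          refine Finset.sum_le_sum fun k hk => ?_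
          have h1 : 160 * 2 ^ I.N k ≤ 320 * I.lam * I.w k := by
            have := I.two_pow_N_le k
            rw [max_eq_right (hTw k hk)] at this
            nlinarith
          calc 160 * 2 ^ I.N k / I.N k ≤ 160 * 2 ^ I.N k / I.logLam :=
                Nat.div_le_div_left (I.logLam_lt_N k).le hlog
            _ ≤ 320 * I.lam * I.w k / I.logLam := Nat.div_le_div_right h1
      _ ≤ (∑ k ∈ T, 320 * I.lam * I.w k) / I.logLam := sum_div_le _ _ _
      _ = 320 * I.lam * (∑ k ∈ T, I.w k) / I.logLam := by rw [Finset.mul_sum]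
      _ ≤ 320 * I.lam * I.θ / I.logLam := Nat.div_le_div_right (Nat.mul_le_mul_left _ hTθ)
  · -- the polylogarithmic part: `|T| ≤ n` terms, each at most the `Nbig` term
    calc ∑ k ∈ T, (I.Δ * I.kA * (I.N k * (2 * I.mI + 3)) + I.Δ * (I.kA + 1))
        ≤ ∑ _k ∈ T, (I.Δ * I.kA * (I.Nbig * (2 * I.mI + 3)) + I.Δ * (I.kA + 1)) :=
          Finset.sum_le_sum fun k _ => by
            have := I.N_le_Nbig k
            gcongr
      _ = T.card * (I.Δ * I.kA * (I.Nbig * (2 * I.mI + 3)) + I.Δ * (I.kA + 1)) := by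
          rw [Finset.sum_const, smul_eq_mul]
      _ ≤ I.n * (I.Δ * I.kA * (I.Nbig * (2 * I.mI + 3)) + I.Δ * (I.kA + 1)) :=
          Nat.mul_le_mul_right _ (by simpa using T.card_le_univ)

/-- **Completeness of the concrete instance.** If a set `T` of positive-weight variables of total
weight `≤ θ` is accepted by every formula, then for EVERY coin outcome the output is in `MCSP*`.
[cite: Hirahara2022PartialMCSP, proof of Lemma 8.3 (completeness, pp. 29–30) and proof of Thm. 8.5 (MCSP* case)] -/
theorem output_mem_of_witness (hG : I.Good) (hmass : ∀ k, (2 * I.τ + 8) * (Nat.log 2 (I.N k) + 2) ≤ I.N k)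
    (T : Finset (Fin I.n)) (hTw : ∀ k ∈ T, 1 ≤ I.w k) (hTθ : ∑ k ∈ T, I.w k ≤ I.θ)
    (hauth : ∀ j, T.image Fin.val ∈ (I.φ j).accessStructure.authorized) (F : Coins I.A) :
    I.output F ∈ MCSPStar := by
  obtain ⟨g, hg, hcons⟩ := cktSize_cons I.E I.φ I.slot I.L (τ := I.τ) (Lj := I.Lj) T F
    (fun k _ => hmass k) I.Δ_mul_kA_le I.ν_le hG.nil_notMem hG.numLiterals_le (I.slot_cover hG) hauth
  have hg' := hg.rewire (eX I.Lj I.dNW I.Δ I.Δ)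
  obtain ⟨C, hC, hs, hev⟩ := hg'.toCircuit
  unfold output
  rw [tableCode_mem_MCSPStar_iff I.ν_le hG.nil_notMem hG.ne_nil hG.numLiterals_le (I.slot_cover hG)]
  refine ⟨C, hC, hs.trans (I.costT_add_le_sP hG T hTw hTθ), fun j z b r => ?_⟩
  rw [hev]
  have : (fun w => xvec (Lj := I.Lj) (point I.E (Fhat I.A F) I.φ I.slot j z b r) (eX I.Lj I.dNW I.Δ I.Δ w)) =
      xbits (Lj := I.Lj) (point I.E (Fhat I.A F) I.φ I.slot j z b r) := funext fun w => xvec_eX _ _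
  simp only [this]
  exact hcons j z b r

/-! ### Soundness of the concrete instance -/

/-- **Soundness of the concrete instance (counting form).** If every set of variables accepted by
all formulas has weight `> W₀`, and the density and final inequalities hold, then at most a third of
the coin outcomes put the output in `MCSP*`. [cite: Hirahara2022PartialMCSP, proof of Lemma 8.3 (soundness, pp. 28–29) and proof of Thm. 8.5 (p. 31)] -/
theorem card_output_mem_mul_three_le (hG : I.Good) (W₀ : ℕ)
    (hNo : ∀ S : Finset (Fin I.n), (∀ j, S.image Fin.val ∈ (I.φ j).accessStructure.authorized) → W₀ < ∑ k ∈ S, I.w k)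
    (hdens : ∀ k, 1 ≤ I.w k → 2 ^ (2 ^ I.N k / 16) * (Fintype.card (Par I.E I.φ k) * Fintype.card (I.A.Suf k) *
        (I.Ccap ^ 2 + 1) * Fintype.card (IWAmp.Adv (I.A.eA k) (m := I.A.mI k)) ^ (I.Ccap ^ 2)) * 4 ^ (2 ^ I.N k) ≤
        2 ^ (2 ^ I.N k) * 3 ^ (2 ^ I.N k - 2 ^ I.N k / 4))
    (hfinal : (tests I.Lj I.ν I.dNW I.Δ I.Δ I.sP).card * 2 ^ I.n * 3 ≤ 2 ^ (2 ^ (I.logLam - 4) * (W₀ + 1))) :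
    ((univ : Finset (Coins I.A)).filter fun F => I.output F ∈ MCSPStar).card * 3 ≤ Fintype.card (Coins I.A) := by
  classical
  haveI : NeZero I.kA := ⟨(I.kA_pos hG.two_le_n).ne'⟩
  set c : Fin I.n → ℕ := fun k => if 1 ≤ I.w k then 2 ^ I.N k / 16 else 0 with hc
  set m := 2 ^ (I.logLam - 4) * (W₀ + 1) with hm
  -- members are consistent with some test
  have hsub : ((univ : Finset (Coins I.A)).filter fun F => I.output F ∈ MCSPStar) ⊆
      (univ : Finset (Coins I.A)).filter fun F =>
        ∃ g ∈ tests I.Lj I.ν I.dNW I.Δ I.Δ I.sP, Cons I.E (Fhat I.A F) I.φ I.slot g := by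
    intro F hF
    rw [mem_filter] at hF ⊢
    refine ⟨hF.1, ?_⟩
    have hmem := hF.2
    unfold output at hmem
    rw [tableCode_mem_MCSPStar_iff I.ν_le hG.nil_notMem hG.ne_nil hG.numLiterals_le (I.slot_cover hG)] at hmem
    obtain ⟨C, hC, hs, hcons⟩ := hmem
    obtain ⟨g, hg, hgC⟩ := exists_mem_tests_of_circuit I.Lj C hC hs
    exact ⟨g, hg, fun j z b r => by rw [hgC]; exact hcons j z b r⟩
  -- the abstract soundness count
  have hkη : (24 : ℝ) ≤ I.kA * I.η := (I.kA_mul_η hG.two_le_n).symm.le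
  have hCη : (8 : ℝ) * I.kA ≤ I.Ccap * I.η := (I.Ccap_mul_η hG.two_le_n).symm.le
  have hmain := card_cons_mul_le (A := I.A) (E := I.E) (φ := I.φ) (slot := I.slot)
    (fun _ => I.idxA_injective) (I.η_pos hG.two_le_n) hkη hCη (I.η_mul_lt hG.two_le_n)
    (tests I.Lj I.ν I.dNW I.Δ I.Δ I.sP) I.w c W₀ m hNo ?_ ?_
  · -- conclude
    have h1 := (Nat.mul_le_mul_right _ (card_le_card hsub)).trans hmain
    -- `# · 2^m ≤ |tests| 2^n |Coins|` and `|tests| 2^n 3 ≤ 2^m`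
    have h2 : ((univ : Finset (Coins I.A)).filter fun F => I.output F ∈ MCSPStar).card * 3 * 2 ^ m ≤
        Fintype.card (Coins I.A) * 2 ^ m := by
      calc ((univ : Finset (Coins I.A)).filter fun F => I.output F ∈ MCSPStar).card * 3 * 2 ^ m
          = ((univ : Finset (Coins I.A)).filter fun F => I.output F ∈ MCSPStar).card * 2 ^ m * 3 := by ring
        _ ≤ (tests I.Lj I.ν I.dNW I.Δ I.Δ I.sP).card * 2 ^ I.n * Fintype.card (Coins I.A) * 3 :=
            Nat.mul_le_mul_right _ h1
        _ = (tests I.Lj I.ν I.dNW I.Δ I.Δ I.sP).card * 2 ^ I.n * 3 * Fintype.card (Coins I.A) := by ring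
        _ ≤ 2 ^ m * Fintype.card (Coins I.A) := Nat.mul_le_mul_right _ hfinal
        _ = Fintype.card (Coins I.A) * 2 ^ m := by ring
    exact Nat.le_of_mul_le_mul_right h2 (pow_pos (by norm_num) m)
  · -- density
    intro k hck
    have hwk : 1 ≤ I.w k := by
      by_contra h0; exact hck (by rw [hc]; simp only; rw [if_neg h0])
    have hceq : c k = 2 ^ I.N k / 16 := by rw [hc]; simp only; rw [if_pos hwk]
    rw [hceq]
    exact hdens k hwk
  · -- heavy sets collect `m` bits
    intro S hS
    have hper : ∀ k ∈ S, 2 ^ (I.logLam - 4) * I.w k ≤ c k := by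
      intro k _
      rw [hc]; simp only
      split_ifs with hwk
      · -- `λ w_k < 2^{N_k}`, `λ = 2^{logLam}`, `logLam ≥ 4`
        have hlt := I.lam_mul_lt_two_pow_N k
        rw [max_eq_right hwk] at hlt
        have hlam : I.lam = 2 ^ (I.logLam - 4) * 16 := by
          unfold lam
          rw [show (16 : ℕ) = 2 ^ 4 by norm_num, ← pow_add, Nat.sub_add_cancel hG.four_le_logLam]
        rw [Nat.le_div_iff_mul_le (by norm_num)]
        calc 2 ^ (I.logLam - 4) * I.w k * 16 = I.w k * I.lam := by rw [hlam]; ring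
          _ ≤ 2 ^ I.N k := hlt.le
      · have : I.w k = 0 := by omega
        simp [this]
    calc m = 2 ^ (I.logLam - 4) * (W₀ + 1) := rfl
      _ ≤ 2 ^ (I.logLam - 4) * ∑ k ∈ S, I.w k := Nat.mul_le_mul_left _ hS
      _ = ∑ k ∈ S, 2 ^ (I.logLam - 4) * I.w k := Finset.mul_sum _ _ _
      _ ≤ ∑ k ∈ S, c k := Finset.sum_le_sum hper

end PInst

end HiraharaRed

end Literature.Computability.Complexity
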